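import Literature.Analysis.FluidPDE.FractionalNSReynoldsInitial
import Literature.Analysis.FluidPDE.EulerReynoldsMollification
import Literature.Analysis.FluidPDE.FracLaplacianSpaceTime
import Literature.Analysis.FluidPDE.FracNSEnergy
import HarnessLib

/-!
# Perturbing a smooth solution of the fractional Navier–Stokes–Reynolds system on `ℝ × 𝕋^d`
  (Luo–Titi 2020, §3.5: "We obtain `R_{q+1}` by plugging `v_{q+1} = v_q + w_{q+1}` in (2.1)")

Analysis/FluidPDE support file (everything proved; no named facts) for the proof of the Iteration
Lemma of T. Luo and E. S. Titi, Calc. Var. PDE 59 (2020) = arXiv:1808.07595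
(`Torus.LuoTiti2020_iterationLemma`, `FluidPDE/FractionalNSReynolds`). In §3.5 the new Reynolds
stress of the scheme is obtained from the old triple `(v_q, p_q, R_q)` and the perturbation
`w_{q+1}`: "using (3.17) [`div ℛu = u - ⨍u`] and the assumption that `(v_q, R_q)` solves (2.1):
`∇·R_{q+1} = ∇·[ℛ(ν(-Δ)^θ w_{q+1} + ∂ₜw^{(p)} + ∂ₜw^{(c)}) + v_q ⊗ w_{q+1} + w_{q+1} ⊗ v_q]
+ ∇·[…] + [∇·(w^{(p)} ⊗ w^{(p)} - R_q) + ∂ₜw^{(t)}] + ∇(p_{q+1} - p_q)`". This file isolates the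
abstract content of that computation, the fractional twin of the tree's
`Torus.IsNSReynoldsOn.perturb` (`FluidPDE/NSRPerturbation`, Cheskidov–Luo Lemmas 4.5–4.6) on the
WHOLE time line and WITHOUT the trace-free / zero-mean-pressure normalisations (which
`Torus.IsFracNSReynoldsOn` does not impose):

* `Torus.IsFracNSReynoldsOn.perturb_univ` — if `(v, p, R)` solves the fractional NSR system with
  exponent `θ > 0` and viscosity `ν` on `ℝ × 𝕋^d` (`d ≥ 2`), `w` is jointly smooth and divergence
  free, and jointly smooth `S` (symmetric), `q`, `f` (zero mean at every time) satisfy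
  `∂ₜw + div(w ⊗ w) + div R = div S + ∇q + f` on `ℝ × 𝕋^d`, then
  `(v + w, p - q, S + v ⊗ w + w ⊗ v + ℛ(f + ν(-Δ)^θ w))` solves the fractional NSR system on
  `ℝ × 𝕋^d` — the hyperviscous term of the increment is inverted by the De Lellis–Székelyhidi
  anti-divergence `ℛ` (`(-Δ)^θ w` has zero mean for `θ > 0`), exactly the `ℛ(ν(-Δ)^θ w_{q+1})`
  of the display above;
* `Torus.IsFracNSReynoldsOn.comp_sub_time` — time translates `t ↦ (v, p, R)(t - c)` of
  solutions on `ℝ × 𝕋^d` are solutions (used to place the bounded temporal support of the data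
  of the Iteration Lemma inside a fixed slab `(0, T)`), with the bookkeeping of supports and
  `δ`-neighbourhoods under translation.

## References

* T. Luo, E. S. Titi, Calc. Var. PDE 59 (2020) = arXiv:1808.07595, §2.1 (2.1), §3.5 (the
  display defining `R_{q+1}`). [`LuoTiti2020`]
* A. Cheskidov, X. Luo, Invent. Math. 229 (2022) = arXiv:2009.06596, §4.5 Lemmas 4.5–4.6.
  [`CheskidovLuo2022`]
-/

noncomputable section

open MeasureTheory Set Filter Function UnitAddTorus
open scoped ENNReal NNReal ContDiff

namespace Literature.Analysis.FluidPDE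

namespace Torus

open FunctionSpaces FunctionSpaces.Torus

variable {d : Type*} [Fintype d] [DecidableEq d]

/-! ## The abstract perturbation step on the whole line -/

section Perturb

variable {θ ν : ℝ} {v w : ℝ → UnitAddTorus d → EuclideanSpace ℝ d} {p q : ℝ → UnitAddTorus d → ℝ}
  {R S : ℝ → UnitAddTorus d → d → EuclideanSpace ℝ d} {f : ℝ → UnitAddTorus d → EuclideanSpace ℝ d}

variable (θ ν v w S f) in
/-- **The new Reynolds stress** `S + v ⊗ w + w ⊗ v + ℛ(f + ν(-Δ)^θ w)` (by columns).
[cite: LuoTiti2020, §3.5 (display defining `R_{q+1}`)] -/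
def fracPerturbedStress : ℝ → UnitAddTorus d → d → EuclideanSpace ℝ d :=
  fun t y j => S t y j + tensorProd (v t) (w t) y j + tensorProd (w t) (v t) y j +
    antidivergence (fun z => f t z + ν • fracLaplacian θ (w t) z) y j

/-- Unfolding `fracPerturbedStress`. [folklore] -/
theorem fracPerturbedStress_apply (t : ℝ) (y : UnitAddTorus d) (j : d) :
    fracPerturbedStress θ ν v w S f t y j = S t y j + tensorProd (v t) (w t) y j + tensorProd (w t) (v t) y j +
      antidivergence (fun z => f t z + ν • fracLaplacian θ (w t) z) y j := rfl

/-- **The abstract perturbation step for the fractional Navier–Stokes–Reynolds system on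
`ℝ × 𝕋^d`.** Let `(v, p, R)` be a smooth solution of (2.1) with exponent `θ > 0` and viscosity `ν`
on the whole time line (`Torus.IsFracNSReynoldsOn univ`), `d ≥ 2`. Let `w` be jointly smooth on
`ℝ × 𝕋^d` and divergence free, and let jointly smooth `S` (symmetric), `q` and `f` with
`∫ f(t) = 0` satisfy the identity
`∂ₜw + div(w ⊗ w) + div R = div S + ∇q + f` on `ℝ × 𝕋^d`.
Then `(v + w, p - q, S + v ⊗ w + w ⊗ v + ℛ(f + ν(-Δ)^θ w))` is a smooth solution of (2.1) on
`ℝ × 𝕋^d`: with `div v = div w = 0` one has `((v+w)·∇)(v+w) = (v·∇)v + div(w ⊗ v + v ⊗ w + w ⊗ w)`,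
`(-Δ)^θ` is additive, `∫(-Δ)^θ w = 0` (`θ > 0`), and `div ℛ g = g - ⨍g`. [cite: LuoTiti2020, §3.5 (display defining `R_{q+1}`)] -/
theorem IsFracNSReynoldsOn.perturb_univ (hd : 2 ≤ Fintype.card d) (hθ : 0 < θ)
    (h : IsFracNSReynoldsOn univ θ ν v p R)
    (hw : Torus.IsSmoothSpaceTimeOn univ w) (hwdiv : ∀ t, IsDivFree (w t))
    (hS : Torus.IsSmoothSpaceTimeOn univ S) (hSsym : ∀ t y, ∀ i j : d, S t y i j = S t y j i)
    (hq : Torus.IsSmoothSpaceTimeOn univ q) (hf : Torus.IsSmoothSpaceTimeOn univ f) (hf0 : ∀ t, ∫ y, f t y = 0)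
    (hid : ∀ t y, Torus.timeDeriv w t y + tensorDivergence (tensorProd (w t) (w t)) y + tensorDivergence (R t) y =
      tensorDivergence (S t) y + Torus.gradient (q t) y + f t y) :
    IsFracNSReynoldsOn univ θ ν (fun t y => v t y + w t y) (fun t y => p t y - q t y)
      (fracPerturbedStress θ ν v w S f) := by
  haveI : Nonempty d := Fintype.card_pos_iff.1 (by omega)
  have hv := h.smooth_velocity
  have hvt : ∀ t, IsSmooth (v t) := fun t => hv.isSmooth_slice (mem_univ t)
  have hwt : ∀ t, IsSmooth (w t) := fun t => hw.isSmooth_slice (mem_univ t)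
  have hSt : ∀ t, IsSmooth (S t) := fun t => hS.isSmooth_slice (mem_univ t)
  have hft : ∀ t, IsSmooth (f t) := fun t => hf.isSmooth_slice (mem_univ t)
  -- the field inverted by `ℛ`: `g = f + ν(-Δ)^θ w`
  set g : ℝ → UnitAddTorus d → EuclideanSpace ℝ d := fun t z => f t z + ν • fracLaplacian θ (w t) z with hg_def
  have hΛ : Torus.IsSmoothSpaceTimeOn univ (fun t => fracLaplacian θ (w t)) := hw.fracLaplacian_univ hθ.le
  have hg : Torus.IsSmoothSpaceTimeOn univ g := hf.add (hΛ.const_smul ν)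
  have hgt : ∀ t, IsSmooth (g t) := fun t => hg.isSmooth_slice (mem_univ t)
  have hg0 : ∀ t, ∫ z, g t z = 0 := by
    intro t
    have hi1 : Integrable (f t) volume := (hft t).integrable
    have hi2 : Integrable (fun z => ν • fracLaplacian θ (w t) z) volume :=
      (integrable_fracLaplacian hθ.le (hwt t)).smul ν
    change ∫ z, (f t z + ν • fracLaplacian θ (w t) z) = 0
    rw [integral_add hi1 hi2, integral_smul, hf0 t, integral_fracLaplacian_eq_zero hθ (hwt t), smul_zero, add_zero]
  -- joint smoothness of the pieces of the stress
  have hA : Torus.IsSmoothSpaceTimeOn univ (fun t => antidivergence (g t)) := hg.antidivergence convex_univ (by simp)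
  have hT1 : Torus.IsSmoothSpaceTimeOn univ (fun t => tensorProd (v t) (w t)) := hv.tensorProd hw
  have hT2 : Torus.IsSmoothSpaceTimeOn univ (fun t => tensorProd (w t) (v t)) := hw.tensorProd hv
  have hstress : Torus.IsSmoothSpaceTimeOn univ (fracPerturbedStress θ ν v w S f) := by
    have e : fracPerturbedStress θ ν v w S f = fun t y j => ((S t y j + tensorProd (v t) (w t) y j) +
        tensorProd (w t) (v t) y j) + antidivergence (g t) y j := rfl
    rw [e]
    exact ((hS.add hT1).add hT2).add hA
  refine
    { smooth_velocity := hv.add hw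
      smooth_pressure := h.smooth_pressure.sub hq
      smooth_stress := hstress
      momentum := ?_
      divFree := fun t _ => IsDivFree.add ((hvt t).isContDiff (by simp)) ((hwt t).isContDiff (by simp))
        (h.divFree t (mem_univ t)) (hwdiv t)
      symm := ?_ }
  · -- momentum
    intro t _ y
    have h1v : IsContDiff 1 (v t) := (hvt t).isContDiff (by simp)
    have h1w : IsContDiff 1 (w t) := (hwt t).isContDiff (by simp)
    -- time derivative
    have eDt : Torus.timeDerivWithin univ (fun t y => v t y + w t y) t y =
        Torus.timeDerivWithin univ v t y + Torus.timeDerivWithin univ w t y :=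
      ((hv.hasDerivWithinAt_slice (mem_univ t) y).add (hw.hasDerivWithinAt_slice (mem_univ t) y)).derivWithin
        (uniqueDiffOn_univ t (mem_univ t))
    have eDtw : Torus.timeDerivWithin univ w t y = Torus.timeDeriv w t y := by rw [timeDerivWithin_univ]
    -- convective term and hyperviscous term
    have eConv : Torus.convect (fun y => v t y + w t y) (fun y => v t y + w t y) y =
        Torus.convect (v t) (v t) y + Torus.convect (v t) (w t) y + (Torus.convect (w t) (v t) y + Torus.convect (w t) (w t) y) := by
      rw [convect_add_left, convect_add_right _ h1v h1w, convect_add_right _ h1v h1w]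
    have eLap : fracLaplacian θ (fun y => v t y + w t y) y = fracLaplacian θ (v t) y + fracLaplacian θ (w t) y := by
      rw [fracLaplacian_add hθ.le (hvt t) (hwt t)]
    -- pressure gradient
    have eGrad : Torus.gradient (fun y => p t y - q t y) y = Torus.gradient (p t) y - Torus.gradient (q t) y := by
      have e1 : (fun y => p t y - q t y) = fun y => p t y + (-1 : ℝ) * q t y := by
        funext z; ring
      have hq1 : IsContDiff 1 (q t) := (hq.isSmooth_slice (mem_univ t)).isContDiff (by simp)
      have hm : IsContDiff 1 (fun z => (-1 : ℝ) * q t z) := by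
        have : IsSmooth (fun z => (-1 : ℝ) * q t z) := contDiff_const.mul (hq.isSmooth_slice (mem_univ t))
        exact this.isContDiff (by simp)
      rw [e1, gradient_add_apply ((h.smooth_pressure.isSmooth_slice (mem_univ t)).isContDiff (by simp)) hm,
        gradient_const_mul_apply hq1]
      simp [sub_eq_add_neg]
    -- divergence of the new stress
    have hSt1 : IsContDiff 1 (S t) := (hSt t).isContDiff (by simp)
    have hP1 : IsContDiff 1 (tensorProd (v t) (w t)) := ((hvt t).tensorProd (hwt t)).isContDiff (by simp)
    have hP2 : IsContDiff 1 (tensorProd (w t) (v t)) := ((hwt t).tensorProd (hvt t)).isContDiff (by simp)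
    have hA1 : IsContDiff 1 (antidivergence (g t)) := (isSmooth_antidivergence (hgt t)).isContDiff (by simp)
    have eDiv : tensorDivergence (fracPerturbedStress θ ν v w S f t) y =
        tensorDivergence (S t) y + (Torus.convect (w t) (v t) y + Torus.convect (v t) (w t) y) + g t y := by
      have e1 : fracPerturbedStress θ ν v w S f t = fun y j => S t y j + (tensorProd (v t) (w t) y j +
          (tensorProd (w t) (v t) y j + antidivergence (g t) y j)) := by
        funext z j; simp only [fracPerturbedStress_apply]; abel
      have hB3 : IsContDiff 1 (fun y j => tensorProd (w t) (v t) y j + antidivergence (g t) y j) := hP2.add hA1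
      have hB2 : IsContDiff 1 (fun y j => tensorProd (v t) (w t) y j +
          (tensorProd (w t) (v t) y j + antidivergence (g t) y j)) := hP1.add hB3
      rw [e1, tensorDivergence_add_apply hSt1 hB2, tensorDivergence_add_apply hP1 hB3,
        tensorDivergence_add_apply hP2 hA1, tensorDivergence_tensorProd (hvt t) (hwt t), tensorDivergence_tensorProd (hwt t) (hvt t),
        hwdiv t y, h.divFree t (mem_univ t) y, zero_smul, zero_smul, add_zero, add_zero,
        tensorDivergence_antidivergence hd (hgt t), hg0 t, sub_zero]
      abel
    -- assemble
    have hUeq := h.momentum t (mem_univ t) y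
    have hW := hid t y
    rw [eDt, eDtw, eConv, eGrad, eLap, eDiv, smul_add]
    set Dv := Torus.timeDerivWithin univ v t y
    set Dw := Torus.timeDeriv w t y
    set Cvv := Torus.convect (v t) (v t) y
    set Cvw := Torus.convect (v t) (w t) y
    set Cwv := Torus.convect (w t) (v t) y
    set Cww := Torus.convect (w t) (w t) y
    set GP := Torus.gradient (p t) y
    set Gq := Torus.gradient (q t) y
    set Lv := ν • fracLaplacian θ (v t) y
    set Lw := ν • fracLaplacian θ (w t) y
    set DR := tensorDivergence (R t) y
    set DS := tensorDivergence (S t) y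
    have eww : tensorDivergence (tensorProd (w t) (w t)) y = Cww := by
      rw [tensorDivergence_tensorProd (hwt t) (hwt t), hwdiv t y, zero_smul, add_zero]
    rw [eww] at hW
    have eg : g t y = f t y + Lw := rfl
    rw [eg]
    -- `hUeq : Dv + Cvv + GP + Lv = DR`, `hW : Dw + Cww + DR = DS + Gq + f`
    have key : Dv + Dw + (Cvv + Cvw + (Cwv + Cww)) + (GP - Gq) + (Lv + Lw) -
        (DS + (Cwv + Cvw) + (f t y + Lw)) =
        (Dv + Cvv + GP + Lv - DR) + (Dw + Cww + DR - (DS + Gq + f t y)) := by abel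
    rw [hUeq, hW, sub_self, sub_self, add_zero, sub_eq_zero] at key
    exact key
  · -- symmetry
    intro t _ y i j
    simp only [fracPerturbedStress_apply, PiLp.add_apply]
    rw [hSsym t y i j, antidivergence_symm (hgt t) y i j, tensorProd_apply, tensorProd_apply,
      tensorProd_apply, tensorProd_apply]
    ring

/-- **The new stress vanishes where all the perturbation data vanish**: if `w(t) = 0`,
`S(t) = 0` and `f(t) = 0` then the new stress vanishes at time `t` (the temporal support of
`R_{q+1}` is contained in `supp_t w ∪ supp_t S ∪ supp_t f`). [cite: LuoTiti2020, §3.5 ("Finally, we estimate the time support of `R_{q+1}`")] -/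
theorem fracPerturbedStress_eq_zero {t : ℝ} (hw0 : w t = 0) (hS0 : S t = 0) (hf0 : f t = 0) :
    fracPerturbedStress θ ν v w S f t = 0 := by
  funext y j
  rw [fracPerturbedStress_apply, hS0, hw0, hf0]
  have h1 : (fun z : UnitAddTorus d => (0 : UnitAddTorus d → EuclideanSpace ℝ d) z +
      ν • fracLaplacian θ (0 : UnitAddTorus d → EuclideanSpace ℝ d) z) = 0 := by
    funext z
    rw [fracLaplacian_zero_fun]
    simp
  simp only [Pi.zero_apply] at h1 ⊢
  rw [show (fun z : UnitAddTorus d => (0 : EuclideanSpace ℝ d) + ν • fracLaplacian θ (0 : UnitAddTorus d → EuclideanSpace ℝ d) z) =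
      (fun z : UnitAddTorus d => (0 : UnitAddTorus d → EuclideanSpace ℝ d) z +
        ν • fracLaplacian θ (0 : UnitAddTorus d → EuclideanSpace ℝ d) z) from rfl] at *
  rw [h1, antidivergence_zero]
  simp [tensorProd]

end Perturb

/-! ## Time translation -/

section Translate

variable {θ ν : ℝ} {v : ℝ → UnitAddTorus d → EuclideanSpace ℝ d} {p : ℝ → UnitAddTorus d → ℝ}
  {R : ℝ → UnitAddTorus d → d → EuclideanSpace ℝ d}

omit [DecidableEq d] in
/-- Time translates of jointly smooth fields on `ℝ × 𝕋^d` are jointly smooth. [folklore] -/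
theorem _root_.Literature.Analysis.FunctionSpaces.Torus.IsSmoothSpaceTimeOn.comp_sub_time_univ
    {F : Type*} [NormedAddCommGroup F] [NormedSpace ℝ F] {u : ℝ → UnitAddTorus d → F}
    (hu : Torus.IsSmoothSpaceTimeOn univ u) (c : ℝ) : Torus.IsSmoothSpaceTimeOn univ (fun t => u (t - c)) := by
  unfold FunctionSpaces.Torus.IsSmoothSpaceTimeOn at hu ⊢
  rw [univ_prod_univ] at hu ⊢
  have hu' : ContDiff ℝ ∞ (stLift u) := contDiffOn_univ.1 hu
  have hmap : ContDiff ℝ ∞ (fun z : ℝ × EuclideanSpace ℝ d => (z.1 - c, z.2)) :=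
    (contDiff_fst.sub contDiff_const).prodMk contDiff_snd
  have e : stLift (fun t => u (t - c)) = stLift u ∘ fun z : ℝ × EuclideanSpace ℝ d => (z.1 - c, z.2) := by
    funext z; rfl
  rw [e]
  exact (hu'.comp hmap).contDiffOn

omit [Fintype d] [DecidableEq d] in
/-- The time derivative commutes with time translation. [folklore] -/
theorem timeDeriv_comp_sub_time {F : Type*} [NormedAddCommGroup F] [NormedSpace ℝ F]
    (u : ℝ → UnitAddTorus d → F) (c t : ℝ) (y : UnitAddTorus d) :
    Torus.timeDeriv (fun s => u (s - c)) t y = Torus.timeDeriv u (t - c) y := by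
  simp only [Torus.timeDeriv]
  exact deriv_comp_sub_const (f := fun s => u s y) (a := c) (x := t)

/-- **Time translates of smooth solutions of (2.1) on `ℝ × 𝕋^d` are smooth solutions.** [folklore] -/
theorem IsFracNSReynoldsOn.comp_sub_time (h : IsFracNSReynoldsOn univ θ ν v p R) (c : ℝ) :
    IsFracNSReynoldsOn univ θ ν (fun t => v (t - c)) (fun t => p (t - c)) (fun t => R (t - c)) where
  smooth_velocity := h.smooth_velocity.comp_sub_time_univ c
  smooth_pressure := h.smooth_pressure.comp_sub_time_univ c
  smooth_stress := h.smooth_stress.comp_sub_time_univ c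
  momentum t _ x := by
    rw [timeDerivWithin_univ, timeDeriv_comp_sub_time]
    have := h.momentum (t - c) (mem_univ _) x
    rwa [timeDerivWithin_univ] at this
  divFree t _ := h.divFree (t - c) (mem_univ _)
  symm t _ := h.symm (t - c) (mem_univ _)

omit [Fintype d] [DecidableEq d] in
/-- The temporal support of a time translate: `supp (t ↦ u(t - c)) = c +ᵥ supp u`
(as the image under `· + c`). [folklore] -/
theorem support_comp_sub_time {F : Type*} [Zero F] (u : ℝ → F) (c : ℝ) :
    Function.support (fun t => u (t - c)) = (fun t => t + c) '' Function.support u := by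
  ext t
  simp only [Function.mem_support, mem_image]
  constructor
  · intro ht
    exact ⟨t - c, ht, by ring⟩
  · rintro ⟨s, hs, rfl⟩
    simpa using hs

omit [Fintype d] [DecidableEq d] in
/-- Translation is an isometry of `ℝ`, so it commutes with `δ`-thickenings. [folklore] -/
theorem thickening_image_add_right (δ c : ℝ) (A : Set ℝ) :
    Metric.thickening δ ((fun t => t + c) '' A) = (fun t => t + c) '' Metric.thickening δ A := by
  have hiso : Isometry (fun t : ℝ => t + c) := isometry_add_right c
  ext t
  simp only [Metric.mem_thickening_iff, mem_image]
  constructor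
  · rintro ⟨_, ⟨s, hs, rfl⟩, hts⟩
    refine ⟨t - c, ⟨s, hs, ?_⟩, by ring⟩
    have : dist (t - c) s = dist t (s + c) := by
      rw [Real.dist_eq, Real.dist_eq]; congr 1; ring
    rwa [this]
  · rintro ⟨s, ⟨r, hr, hsr⟩, rfl⟩
    refine ⟨r + c, ⟨r, hr, rfl⟩, ?_⟩
    rwa [hiso.dist_eq]

omit [Fintype d] [DecidableEq d] in
/-- Bounded sets stay bounded under translation. [folklore] -/
theorem _root_.Bornology.IsBounded.image_add_right {A : Set ℝ} (hA : Bornology.IsBounded A) (c : ℝ) :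
    Bornology.IsBounded ((fun t => t + c) '' A) :=
  (isometry_add_right c).lipschitz.isBounded_image hA

end Translate

end Torus

end Literature.Analysis.FluidPDE
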